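import Summits.PneNP.PneNP.Theorems.SupportRectangleBlockLiftRobust
import Literature.Barriers.PneNP.MatchingSlackPsdApproximation
import HarnessLib

/-!
# A ceiling for support-robust small-block arguments (papers lane, 2026-08-27)

`SupportRectangleBlockLift.blockPsd_explicit_robust` proves its block bound for EVERY matrix `S'` on
(odd sets) × (perfect matchings of `K_n`) that vanishes where the odd-cut slack `pmSlack` does and is within
`1/4` of it elsewhere. Kaniewski–Lee–de Wolf [cite: KaniewskiLeeDewolf2015, Thm. 19] (typed in the tree as
the named fact `Literature.Barriers.PneNP.KaniewskiLeeDewolf2015_thm19`) provide such an `S'` with ONE psd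
block of size `2^{O(n^{1/2+ε} log² n)}`. Hence (this file, conditional on the named fact):

* `supportRobust_blockSize_ceiling` — for every `ε > 0` there are `C, n₀` such that for every even `n ≥ n₀`:
  if `R` is a lower bound on the block size valid for every single-block psd factorisation of every such
  `S'` (the hypotheses of `blockPsd_explicit_robust` with `m = 1`), then `R ≤ 2^{C n^{1/2+ε} (log n)²}`.

So no statement provable from those hypotheses alone forces one block larger than `2^{Õ(√n)}` — while
`blockPsd_explicit_robust` itself forces `Ω(n / log n)` for polynomially many blocks. This is the block
analogue of the tree's `KaniewskiLeeDewolf2015_thm19.ceiling` (approximation-robust psd-rank bounds).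
WHAT THIS IS NOT: not a statement about the psd rank of the slack matrix itself; conditional on the cited
theorem (hypothesis `hKLW`); nothing P-vs-NP-relevant.
-/

set_option linter.dupNamespace false -- `Summit.PneNP.PneNP.…`: summit = sub-problem (D-0017)

noncomputable section

open scoped Classical

open Finset Real Matrix Literature.Barriers.PneNP Literature.Combinatorics.Optimization

namespace Summit.PneNP.PneNP.Theorems.SupportRectangleBlockLift

/-- **Ceiling for support-robust block-size bounds** (conditional on [cite: KaniewskiLeeDewolf2015, Thm. 19],
the tree's named fact `KaniewskiLeeDewolf2015_thm19`). For every `ε > 0` there are `C` and `n₀` such that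
for every even `n ≥ n₀` and every `R : ℕ`: if `R ≤ b` holds for EVERY real matrix `S'` on (odd vertex sets)
× (perfect matchings of `K_n`) with `S' = 0` wherever `pmSlack = 0` and `|S' − pmSlack| ≤ 1/4`, and every
writing `S' U M = Tr(A(M) B(U))` with ONE pair of real psd `b × b` blocks (the hypotheses of
`blockPsd_explicit_robust` at `m = 1`), then `R ≤ 2^{C · n^{1/2+ε} · (log n)²}`. Proof: the
Kaniewski–Lee–de Wolf perturbation `S̃` is such an `S'` for `n` large (it is exact where
`|δ(U) ∩ M| ≤ (n/2)^{2ε}`, in particular on the zeros, and within `2^{−(n/2)^{2ε}} ≤ 1/4` elsewhere once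
`(n/2)^{2ε} ≥ 2`), and it has a psd factorisation of size `r ≤ 2^{C n^{1/2+ε} (log n)²}`. -/
theorem supportRobust_blockSize_ceiling (hKLW : KaniewskiLeeDewolf2015_thm19) {ε : ℝ} (hε : 0 < ε) :
    ∃ C : ℝ, ∃ n₀ : ℕ, ∀ n : ℕ, n₀ ≤ n → Even n → ∀ R : ℕ,
      (∀ (S' : Finset (Fin n) → Finset (Sym2 (Fin n)) → ℝ) (b : ℕ)
          (A : Finset (Sym2 (Fin n)) → Fin 1 → Matrix (Fin b) (Fin b) ℝ)
          (B : Finset (Fin n) → Fin 1 → Matrix (Fin b) (Fin b) ℝ),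
          (∀ M i, IsPMOn (univ : Finset (Fin n)) M → (A M i).PosSemidef) →
          (∀ U i, Odd U.card → (B U i).PosSemidef) →
          (∀ U M, Odd U.card → IsPMOn (univ : Finset (Fin n)) M → pmSlack U M = 0 → S' U M = 0) →
          (∀ U M, Odd U.card → IsPMOn (univ : Finset (Fin n)) M → |S' U M - pmSlack U M| ≤ 1 / 4) →
          (∀ U M, Odd U.card → IsPMOn (univ : Finset (Fin n)) M →
            S' U M = ∑ i, (A M i * B U i).trace) →
          R ≤ b) →
      (R : ℝ) ≤ (2 : ℝ) ^ (C * (n : ℝ) ^ (1 / 2 + ε) * Real.log n ^ 2) := by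
  obtain ⟨C, n₀, H⟩ := hKLW ε hε
  -- threshold: `(n/2)^{2ε} ≥ 2` as soon as `n ≥ 2 · 2^{1/(2ε)}`
  set T : ℝ := 2 * (2 : ℝ) ^ (1 / (2 * ε)) with hT
  refine ⟨C, max n₀ ⌈T⌉₊, fun n hn heven R hR => ?_⟩
  have hn₀ : n₀ ≤ n := le_trans (le_max_left _ _) hn
  have hnT : T ≤ (n : ℝ) := (Nat.le_ceil T).trans (by exact_mod_cast le_trans (le_max_right _ _) hn)
  obtain ⟨r, St, hr, ⟨A₀, B₀, hA₀, hB₀, hfac₀⟩, hpert⟩ := H n hn₀ heven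
  -- the perturbation size: `2^{-(n/2)^{2ε}} ≤ 1/4`, and `(n/2)^{2ε} ≥ 1`
  have h2ε : 0 < 2 * ε := by positivity
  have hbase : (2 : ℝ) ^ (1 / (2 * ε)) ≤ (n : ℝ) / 2 := by
    rw [hT] at hnT
    linarith
  have hpow2 : (2 : ℝ) ≤ ((n : ℝ) / 2) ^ (2 * ε) := by
    have h1 : ((2 : ℝ) ^ (1 / (2 * ε))) ^ (2 * ε) ≤ ((n : ℝ) / 2) ^ (2 * ε) :=
      Real.rpow_le_rpow (by positivity) hbase h2ε.le
    have h2 : ((2 : ℝ) ^ (1 / (2 * ε))) ^ (2 * ε) = 2 := by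
      rw [← Real.rpow_mul (by norm_num : (0 : ℝ) ≤ 2)]
      have : 1 / (2 * ε) * (2 * ε) = 1 := by field_simp
      rw [this, Real.rpow_one]
    linarith
  have hpow1 : (1 : ℝ) ≤ ((n : ℝ) / 2) ^ (2 * ε) := by linarith
  have hsmall : (2 : ℝ) ^ (-(((n : ℝ) / 2) ^ (2 * ε))) ≤ 1 / 4 := by
    calc (2 : ℝ) ^ (-(((n : ℝ) / 2) ^ (2 * ε))) ≤ (2 : ℝ) ^ (-(2 : ℝ)) :=
          Real.rpow_le_rpow_of_exponent_le (by norm_num) (by linarith)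
      _ = 1 / 4 := by
          rw [Real.rpow_neg (by norm_num : (0 : ℝ) ≤ 2)]
          norm_num
  -- the matrix `S̃` in the raw-finset currency, and its one-block factorisation
  let S' : Finset (Fin n) → Finset (Sym2 (Fin n)) → ℝ := fun U M =>
    if h : Odd U.card ∧ IsPMOn (univ : Finset (Fin n)) M then St ⟨U, h.1⟩ ⟨M, h.2⟩ else 0
  let A : Finset (Sym2 (Fin n)) → Fin 1 → Matrix (Fin r) (Fin r) ℝ := fun M _ =>
    if h : IsPMOn (univ : Finset (Fin n)) M then B₀ ⟨M, h⟩ else 0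
  let B : Finset (Fin n) → Fin 1 → Matrix (Fin r) (Fin r) ℝ := fun U _ =>
    if h : Odd U.card then A₀ ⟨U, h⟩ else 0
  have hAps : ∀ M i, IsPMOn (univ : Finset (Fin n)) M → (A M i).PosSemidef := by
    intro M i hM
    simp only [A, dif_pos hM]
    exact hB₀ _
  have hBps : ∀ U i, Odd U.card → (B U i).PosSemidef := by
    intro U i hU
    simp only [B, dif_pos hU]
    exact hA₀ _
  -- slack bridge and the two admissibility properties
  have hS'val : ∀ (U : Finset (Fin n)) (M : Finset (Sym2 (Fin n))) (hU : Odd U.card)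
      (hM : IsPMOn (univ : Finset (Fin n)) M), S' U M = St ⟨U, hU⟩ ⟨M, hM⟩ := by
    intro U M hU hM
    simp only [S', dif_pos (And.intro hU hM)]
  have hslack : ∀ (U : Finset (Fin n)) (M : Finset (Sym2 (Fin n))) (hU : Odd U.card)
      (hM : IsPMOn (univ : Finset (Fin n)) M),
      pmSlack U M = pmOddCutSlack n ⟨U, hU⟩ ⟨M, hM⟩ := by
    intro U M hU hM
    exact (pmOddCutSlack_eq_pmSlack ⟨U, hU⟩ ⟨M, hM⟩).symm
  have hzero : ∀ U M, Odd U.card → IsPMOn (univ : Finset (Fin n)) M → pmSlack U M = 0 → S' U M = 0 := by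
    intro U M hU hM h0
    rw [hS'val U M hU hM]
    rw [hslack U M hU hM] at h0
    have hcc : (cc ⟨U, hU⟩ ⟨M, hM⟩ : ℝ) = 1 := by
      rw [pmOddCutSlack_apply] at h0
      linarith
    have hle : (cc ⟨U, hU⟩ ⟨M, hM⟩ : ℝ) ≤ ((n : ℝ) / 2) ^ (2 * ε) := by rw [hcc]; exact hpow1
    rw [(hpert ⟨U, hU⟩ ⟨M, hM⟩).1 hle, h0]
  have hclose : ∀ U M, Odd U.card → IsPMOn (univ : Finset (Fin n)) M →
      |S' U M - pmSlack U M| ≤ 1 / 4 := by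
    intro U M hU hM
    rw [hS'val U M hU hM, hslack U M hU hM]
    by_cases hc : (cc ⟨U, hU⟩ ⟨M, hM⟩ : ℝ) ≤ ((n : ℝ) / 2) ^ (2 * ε)
    · rw [(hpert ⟨U, hU⟩ ⟨M, hM⟩).1 hc, sub_self, abs_zero]
      norm_num
    · push Not at hc
      obtain ⟨h1, h2⟩ := (hpert ⟨U, hU⟩ ⟨M, hM⟩).2 hc
      rw [abs_le]
      constructor <;> linarith
  have hfac : ∀ U M, Odd U.card → IsPMOn (univ : Finset (Fin n)) M →
      S' U M = ∑ i, (A M i * B U i).trace := by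
    intro U M hU hM
    rw [hS'val U M hU hM, Fintype.sum_unique]
    simp only [A, B, dif_pos hM, dif_pos hU]
    rw [Matrix.trace_mul_comm]
    exact hfac₀ ⟨U, hU⟩ ⟨M, hM⟩
  -- apply the hypothesis to `S̃`: `R ≤ r ≤ 2^{C n^{1/2+ε} log² n}`
  have hRr : R ≤ r := hR S' r A B hAps hBps hzero hclose hfac
  exact le_trans (by exact_mod_cast hRr) hr

end Summit.PneNP.PneNP.Theorems.SupportRectangleBlockLift

end
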